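import Mathlib.Analysis.SpecialFunctions.Pow.Real
import Mathlib.Algebra.Order.BigOperators.Group.Finset
import Mathlib.Algebra.BigOperators.Ring.Finset
import HarnessLib

/-!
# `NoHeavyLowerTail` (stmt-CriticalPhenomena-4575) — the TP₂ criterion behind COND_TOP: coefficientwise 2×2 minors control ratios of
# polynomials with nonnegative coefficients

Support file, seat `prim-l12-p5` (gen 19), `--supports stmt-CriticalPhenomena-4575`.  Standard axioms, no sorries, no named facts.

Gen 18's top-peeling theorem needs COND_TOP: `λ ↦ λ·c_W(λ)/z_O(λ)` non-decreasing on `(0,1]`, where (gen 19, memo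
FROM-prim-l12-p5-g19-COND-TOP-TP2 §1–3 and REDUCTION-PROOF-g19 §3) `z_O(λ) = Σ_k z_k λ^k` and `λc_W(λ) = Σ_k c_{k−1} λ^k` are polynomials with
NONNEGATIVE coefficients (cycle-weighted permutation counts).  The reduction "(TP₂) `c_k z_k ≥ c_{k−1} z_{k+1}` for all `k` ⟹ COND_TOP" rests on the
elementary fact formalised here: if two coefficient sequences `a, b ≥ 0` satisfy the 2×2-minor condition `a_l b_k ≤ a_k b_l` for `l ≤ k`, then
`(Σ a_k s^k)(Σ b_k t^k) ≤ (Σ a_k t^k)(Σ b_k s^k)` for `0 ≤ s ≤ t` (`sum_mul_sum_le_of_minor`), i.e. `p/q` is non-decreasing where `q > 0`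
(`div_le_div_of_minor`).  Proof: symmetrise the double sum; every term `(a_k b_l − a_l b_k)(t^k s^l − t^l s^k)` is `≥ 0`.
[this work; folklore (total positivity of order 2, cf. Karlin, *Total Positivity* (1968), ch. 1)]
-/

namespace Summit.CriticalPhenomena.PercolationContinuityZ3.Theorems

namespace SahiFreeSlot

open Finset

/-- For `0 ≤ s ≤ t` and natural numbers `k, l`: the "monomial minor" `t^k s^l − t^l s^k` has the sign of `k − l`; here the case `l ≤ k`. [folklore] -/
theorem pow_mul_pow_le_of_le {s t : ℝ} (hs : 0 ≤ s) (hst : s ≤ t) {k l : ℕ} (hlk : l ≤ k) :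
    t ^ l * s ^ k ≤ t ^ k * s ^ l := by
  obtain ⟨d, rfl⟩ := Nat.exists_eq_add_of_le hlk
  have ht : 0 ≤ t := hs.trans hst
  have h1 : s ^ d ≤ t ^ d := pow_le_pow_left₀ hs hst d
  have h2 : 0 ≤ t ^ l * s ^ l := mul_nonneg (pow_nonneg ht l) (pow_nonneg hs l)
  calc t ^ l * s ^ (l + d) = (t ^ l * s ^ l) * s ^ d := by rw [pow_add]; ring
    _ ≤ (t ^ l * s ^ l) * t ^ d := mul_le_mul_of_nonneg_left h1 h2
    _ = t ^ (l + d) * s ^ l := by rw [pow_add]; ring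

/-- Every symmetrised term `(a_k b_l − a_l b_k)·(t^k s^l − t^l s^k)` is nonnegative when the coefficient sequences satisfy the
2×2-minor condition `a_l b_k ≤ a_k b_l` (`l ≤ k`) and `0 ≤ s ≤ t`. [folklore] -/
theorem minor_term_nonneg (a b : ℕ → ℝ) (h : ∀ k l, l ≤ k → a l * b k ≤ a k * b l)
    {s t : ℝ} (hs : 0 ≤ s) (hst : s ≤ t) (k l : ℕ) :
    0 ≤ (a k * b l - a l * b k) * (t ^ k * s ^ l - t ^ l * s ^ k) := by
  rcases le_total l k with hlk | hkl
  · exact mul_nonneg (sub_nonneg.mpr (h k l hlk)) (sub_nonneg.mpr (pow_mul_pow_le_of_le hs hst hlk))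
  · have h1 : a k * b l - a l * b k ≤ 0 := sub_nonpos.mpr (h l k hkl)
    have h2 : t ^ k * s ^ l - t ^ l * s ^ k ≤ 0 := sub_nonpos.mpr (pow_mul_pow_le_of_le hs hst hkl)
    exact mul_nonneg_of_nonpos_of_nonpos h1 h2

/-- **TP₂ criterion, product form.**  If `a_l b_k ≤ a_k b_l` for all `l ≤ k`, then for `0 ≤ s ≤ t`:
`(Σ_{k<N} a_k s^k)·(Σ_{k<N} b_k t^k) ≤ (Σ_{k<N} a_k t^k)·(Σ_{k<N} b_k s^k)`. [this work; folklore] -/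
theorem sum_mul_sum_le_of_minor (N : ℕ) (a b : ℕ → ℝ) (h : ∀ k l, l ≤ k → a l * b k ≤ a k * b l)
    {s t : ℝ} (hs : 0 ≤ s) (hst : s ≤ t) :
    (∑ k ∈ range N, a k * s ^ k) * (∑ k ∈ range N, b k * t ^ k)
      ≤ (∑ k ∈ range N, a k * t ^ k) * (∑ k ∈ range N, b k * s ^ k) := by
  rw [← sub_nonneg]
  -- the difference as a double sum of antisymmetrised terms
  have key : (∑ k ∈ range N, a k * t ^ k) * (∑ k ∈ range N, b k * s ^ k)
      - (∑ k ∈ range N, a k * s ^ k) * (∑ k ∈ range N, b k * t ^ k)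
      = (1 / 2 : ℝ) * ∑ k ∈ range N, ∑ l ∈ range N, (a k * b l - a l * b k) * (t ^ k * s ^ l - t ^ l * s ^ k) := by
    have e1 : (∑ k ∈ range N, a k * t ^ k) * (∑ k ∈ range N, b k * s ^ k)
        = ∑ k ∈ range N, ∑ l ∈ range N, a k * b l * (t ^ k * s ^ l) := by
      rw [sum_mul_sum]
      refine sum_congr rfl fun k _ => sum_congr rfl fun l _ => by ring
    have e2 : (∑ k ∈ range N, a k * s ^ k) * (∑ k ∈ range N, b k * t ^ k)
        = ∑ k ∈ range N, ∑ l ∈ range N, a l * b k * (t ^ k * s ^ l) := by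
      rw [sum_mul_sum, sum_comm]
      refine sum_congr rfl fun k _ => sum_congr rfl fun l _ => by ring
    have e3 : ∑ k ∈ range N, ∑ l ∈ range N, (a k * b l - a l * b k) * (t ^ k * s ^ l - t ^ l * s ^ k)
        = ∑ k ∈ range N, ∑ l ∈ range N, (a k * b l - a l * b k) * (t ^ k * s ^ l)
          + ∑ k ∈ range N, ∑ l ∈ range N, (a l * b k - a k * b l) * (t ^ l * s ^ k) := by
      rw [← sum_add_distrib]
      refine sum_congr rfl fun k _ => ?_
      rw [← sum_add_distrib]
      refine sum_congr rfl fun l _ => by ring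
    have e4 : ∑ k ∈ range N, ∑ l ∈ range N, (a l * b k - a k * b l) * (t ^ l * s ^ k)
        = ∑ k ∈ range N, ∑ l ∈ range N, (a k * b l - a l * b k) * (t ^ k * s ^ l) := by
      rw [sum_comm]
    rw [e1, e2, e3, e4, ← sum_sub_distrib]
    have e5 : ∀ k ∈ range N, ∑ l ∈ range N, a k * b l * (t ^ k * s ^ l) - ∑ l ∈ range N, a l * b k * (t ^ k * s ^ l)
        = ∑ l ∈ range N, (a k * b l - a l * b k) * (t ^ k * s ^ l) := by
      intro k _
      rw [← sum_sub_distrib]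
      refine sum_congr rfl fun l _ => by ring
    rw [sum_congr rfl e5]
    ring
  rw [key]
  refine mul_nonneg (by norm_num) (sum_nonneg fun k _ => sum_nonneg fun l _ => ?_)
  exact minor_term_nonneg a b h hs hst k l

/-- **TP₂ criterion, ratio form** (the step "(TP₂) ⟹ COND_TOP"): under the minor condition, `p(s)/q(s) ≤ p(t)/q(t)` for `0 ≤ s ≤ t`
whenever `q(s), q(t) > 0`, where `p = Σ a_k X^k`, `q = Σ b_k X^k`. [this work; folklore] -/
theorem div_le_div_of_minor (N : ℕ) (a b : ℕ → ℝ) (h : ∀ k l, l ≤ k → a l * b k ≤ a k * b l)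
    {s t : ℝ} (hs : 0 ≤ s) (hst : s ≤ t)
    (hqs : 0 < ∑ k ∈ range N, b k * s ^ k) (hqt : 0 < ∑ k ∈ range N, b k * t ^ k) :
    (∑ k ∈ range N, a k * s ^ k) / (∑ k ∈ range N, b k * s ^ k)
      ≤ (∑ k ∈ range N, a k * t ^ k) / (∑ k ∈ range N, b k * t ^ k) := by
  rw [div_le_div_iff₀ hqs hqt]
  exact sum_mul_sum_le_of_minor N a b h hs hst

/-- The consecutive form of the minor condition implies the general one when the `b`'s are positive: if `a_{k} b_{k+1} ≤ a_{k+1} b_k`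
for all `k` and `b_k > 0`, then `a_l b_k ≤ a_k b_l` for all `l ≤ k`. [folklore] -/
theorem minor_of_consecutive (a b : ℕ → ℝ) (hb : ∀ k, 0 < b k)
    (h : ∀ k, a k * b (k + 1) ≤ a (k + 1) * b k) : ∀ k l, l ≤ k → a l * b k ≤ a k * b l := by
  -- a_l / b_l is non-decreasing in l
  have step : ∀ l, a l / b l ≤ a (l + 1) / b (l + 1) := by
    intro l
    rw [div_le_div_iff₀ (hb l) (hb (l + 1))]
    exact h l
  have mono : ∀ l d, a l / b l ≤ a (l + d) / b (l + d) := by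
    intro l d
    induction d with
    | zero => simp
    | succ d ih => exact ih.trans (by simpa [Nat.add_assoc] using step (l + d))
  intro k l hlk
  obtain ⟨d, rfl⟩ := Nat.exists_eq_add_of_le hlk
  have hh := mono l d
  rw [div_le_div_iff₀ (hb l) (hb (l + d))] at hh
  linarith [hh]

end SahiFreeSlot

end Summit.CriticalPhenomena.PercolationContinuityZ3.Theorems
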